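import Mathlib
import Summits.NavierStokesRegularity.NavierStokesRegularity.Theorems.FilamentSkeletonRssAnalyticStripLiaSymbolNumericsCert
import Summits.NavierStokesRegularity.NavierStokesRegularity.Theorems.FilamentSkeletonRssClause13LiaSymbolDeriv
import Summits.NavierStokesRegularity.NavierStokesRegularity.Theorems.FilamentSkeletonRssClause13LiaSymbolDerivWindowDefs

/-!
# Clause 13-J/13-R, brick B5 (BAND WINDOW, certified numerics): `𝔖′(x) ≥ 9x/200` for `0.85 ≤ x ≤ 3.63`

Route `FilamentSkeletonRss`, ∃-side clause 13 (`Clause13RNearStraightL` stmt-NavierStokesRegularity-23612; typing-agnostic); design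
`filament-plan/DESIGN-28296-model-gluing-g16.md` §1/§4 n1b: the BAND window of the model gluing is where the Mourre estimate (`model_band_estimate`, p694551)
applies, i.e. where the self symbol's slope `𝔖′(z√q)` is bounded below by `σ₀ > 0`.  With the closed form `𝔖′(x) = (x/2)·Φ′(x²/4)`,
`Φ′ = 2C − E` (`…Clause13LiaSymbolDeriv`), and `C`, `E` antitone, on a `p`-cell `[a,b]` one has `Φ′ ≥ 2C(b) − E(a) ≥ 2·lowerC(b) − Eup(a)` with the
bracket sums of the `t`-grid of record (`…AnalyticStripLiaSymbolNumericsDefs/Cert`, lane g12):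

* §1 soundness of the cell checker `cellOKDer` / `cellsOKDer` (definitions and the 271-node `p`-grid in `…Clause13LiaSymbolDerivWindowDefs`);
* §2 `certificateDer` — ONE `native_decide`: `Φ′ ≥ 9/100` on `p ∈ [0.18, 3.3]` (float replay margin ≥ 5·10⁻⁴ at the top cell, ≥ 10⁻² elsewhere);
* §3 `deriv_Phi_ge_window` and **`deriv_liaSym_ge_band`: `9x/200 ≤ 𝔖′(x)` for `x ∈ [17/20, 363/100]`** (so `𝔖′ ≥ 0.038` there; true values
  `0.14 … 0.33 … 0.19`).  Combined with the negative window (`…Clause13LiaSymbolNegWindow`, `𝔖 ≤ −1/64` on `[1/4, 19/20]`) and the far branch, the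
  four windows of the gluing design overlap.
Lane ns-filament-19175-p1 g16; `--supports stmt-NavierStokesRegularity-23612 --as helper`; COMPUTATIONAL (one `native_decide`).
HONEST FRAMING: certified numerics for one explicit real integral, serving a HYPOTHETICAL filament-skeleton line on the NEGATIVE side of a MODEL route;
nothing here bears on Navier–Stokes regularity or blow-up.
-/

set_option linter.dupNamespace false

noncomputable section

namespace Summit.NavierStokesRegularity.NavierStokesRegularity.Theorems.AnalyticStripLiaSymbol

open Real Set MeasureTheory Filter Topology

namespace Numerics

/-! ## §1 Soundness of the band-window cell check -/

/-- Soundness of one band-window cell: on `[a,b]`, `φ₀ ≤ Φ′ = 2C − E`. -/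
theorem cellOKDer_sound {φ₀ : ℚ} {x : ℚ × ℚ × ℚ} {rest : List (ℚ × ℚ × ℚ)} (hg : gridOK (x :: rest) = true)
    (he : Encl (x :: rest)) {a b : ℚ} (h : cellOKDer φ₀ (x :: rest) a b = true) :
    ∀ p : ℝ, (a:ℝ) ≤ p → p ≤ (b:ℝ) → (φ₀:ℝ) ≤ 2 * Cint p - Eint p := by
  simp only [cellOKDer, Bool.and_eq_true, decide_eq_true_eq] at h
  obtain ⟨⟨ha, hab⟩, hlo⟩ := h
  have hb : 0 < b := ha.trans_le hab
  intro p hap hpb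
  have ha' : (0:ℝ) < a := by exact_mod_cast ha
  have hp : 0 < p := ha'.trans_le hap
  have hlo' : (φ₀:ℝ) ≤ 2 * (lowerC b (x :: rest) : ℝ) - (Eup a (x :: rest) : ℝ) := by
    have := (Rat.cast_le (K := ℝ)).mpr hlo; push_cast at this; exact this
  have hC_lo := lowerC_le_Cint hb.le hg he        -- lowerC b ≤ C b
  have hE_hi := Eint_le_Eup ha hg he              -- E a ≤ Eup a
  have hCb : Cint (b:ℝ) ≤ Cint p := Cint_antitone hp.le hpb
  have hEa : Eint p ≤ Eint (a:ℝ) := Eint_antitone ha' hap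
  linarith

/-- Soundness of the chained band-window checks on `[a, last]`. -/
theorem cellsOKDer_sound {φ₀ : ℚ} {x : ℚ × ℚ × ℚ} {trest : List (ℚ × ℚ × ℚ)} (hg : gridOK (x :: trest) = true)
    (he : Encl (x :: trest)) :
    ∀ (rest : List ℚ) (a : ℚ), cellsOKDer φ₀ (x :: trest) (a :: rest) = true → rest ≠ [] →
      ∀ p : ℝ, (a:ℝ) ≤ p → p ≤ (lastQ a rest : ℝ) → (φ₀:ℝ) ≤ 2 * Cint p - Eint p := by
  intro rest
  induction rest with
  | nil => intro a _ hne; exact absurd rfl hne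
  | cons b rest ih =>
    intro a hc _ p hap hpl
    simp only [cellsOKDer, Bool.and_eq_true] at hc
    obtain ⟨hcell, hrest⟩ := hc
    by_cases hpb : p ≤ (b:ℝ)
    · exact cellOKDer_sound hg he hcell p hap hpb
    · have hbp : (b:ℝ) ≤ p := le_of_lt (not_le.mp hpb)
      cases rest with
      | nil =>
        simp only [lastQ] at hpl
        exact absurd hpl hpb
      | cons c rest' =>
        exact ih b hrest (List.cons_ne_nil _ _) p hbp (by simpa [lastQ] using hpl)

/-! ## §2 The kernel-replayed certificate -/

/-- THE CERTIFICATE for the band window (the one computational step of this file). -/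
theorem certificateDer :
    (cellsOKDer (9 / 100) tdata ((18 / 100 : ℚ) :: pgridDerTail)
      && decide (lastQ (18 / 100 : ℚ) pgridDerTail = 33 / 10)) = true := by
  native_decide

/-! ## §3 The real-variable windows -/

/-- **`Φ′(p) = 2C(p) − E(p) ≥ 9/100` for `0.18 ≤ p ≤ 3.3`.** -/
theorem two_mul_Cint_sub_Eint_ge_window (p : ℝ) (h1 : 18 / 100 ≤ p) (h2 : p ≤ 33 / 10) : 9 / 100 ≤ 2 * Cint p - Eint p := by
  have hc := certificate
  simp only [Bool.and_eq_true, decide_eq_true_eq] at hc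
  obtain ⟨⟨⟨⟨hgrid, hnn⟩, _⟩, _⟩, hne0⟩ := hc
  have hcd := certificateDer
  simp only [Bool.and_eq_true, decide_eq_true_eq] at hcd
  obtain ⟨hcells, hlast⟩ := hcd
  have htdata : tdata = (tgrid.map fun t => (t, expNegLo t, expNegHi t)) := rfl
  obtain ⟨x, trest, hx⟩ := List.exists_cons_of_ne_nil hne0
  rw [hx] at hgrid hcells
  have he : Encl (x :: trest) := by rw [← hx, htdata]; exact encl_of_nonneg hnn
  have hne : pgridDerTail ≠ [] := by decide
  have h := cellsOKDer_sound hgrid he pgridDerTail (18 / 100) hcells hne p (by push_cast; linarith)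
    (by rw [hlast]; push_cast; linarith)
  have e : (((9 / 100 : ℚ) : ℝ)) = 9 / 100 := by norm_num
  rw [e] at h
  exact h

end Numerics

/-- **THE BAND WINDOW OF THE SELF-INDUCTION SYMBOL: `9x/200 ≤ 𝔖′(x)` for `17/20 ≤ x ≤ 363/100`** (closed form `𝔖′ = (x/2)(2C − E)(x²/4)` +
certified numerics; in particular `𝔖′ ≥ 0.038` on the window). [folklore; kernel-replayed bracket quadrature] -/
theorem deriv_liaSym_ge_band (x : ℝ) (h1 : 17 / 20 ≤ x) (h2 : x ≤ 363 / 100) : 9 * x / 200 ≤ deriv liaSym x := by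
  have hx : 0 < x := by linarith
  rw [Numerics.deriv_liaSym_eq hx]
  have hw := Numerics.two_mul_Cint_sub_Eint_ge_window (x ^ 2 / 4) (by nlinarith) (by nlinarith)
  have hx2 : 0 ≤ x / 2 := by linarith
  calc 9 * x / 200 = x / 2 * (9 / 100) := by ring
    _ ≤ x / 2 * (2 * Numerics.Cint (x ^ 2 / 4) - Numerics.Eint (x ^ 2 / 4)) := mul_le_mul_of_nonneg_left hw hx2

end Summit.NavierStokesRegularity.NavierStokesRegularity.Theorems.AnalyticStripLiaSymbol

end
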